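import Mathlib
import Summits.Ventures.HodgeRepro.Tier4.Line1.RTFSetting
import Summits.Ventures.HodgeRepro.Tier4.Line1.InnerCalculus
import Summits.Ventures.HodgeRepro.Tier4.Line1.InnerBridge
import Summits.Ventures.HodgeRepro.Tier4.Line1.OrthComplement
import Summits.Ventures.HodgeRepro.Tier4.Line1.MaximalFamily
import Summits.Ventures.HodgeRepro.Tier4.Line1.AdaptedONBGlue

/-!
# Tier4/Line4/AdaptedONBPrefix — the three rungs of an adapted ONB with PRESCRIBED constituents and blocks: Zorn above
a given family, enumeration with the given family first, and Gram–Schmidt with a function-level orthonormal PREFIX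

Blind re-derivation cell `pub-hodge-repro`, Tier 4 «prove the step» (README §9–§10), seat t4-L4-p1 (prover, LINE L4,
gen 3; self-pointed cut S13497).  Tree path `lean/Summits/Ventures/HodgeRepro/Tier4/Line4/AdaptedONBPrefix.lean`.
Mathlib-level; no literature.  Generic over any `S : RTF.Setting G` (L1's vocabulary, `Line1/RTFSetting`); the
assembly is `Line4/AdaptedONBExtending.lean`.

WHAT IS PROVED.  (1) `exists_maximal_orthFamily_extending`: every orthogonal family of non-zero irreducible invariant
subspaces (`IsOrthFamily`, `Line1/MaximalFamily`) lies in a maximal one (Zorn with a lower bound).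
(2) `exists_enumeration_orthFamily_first`: a `{0}`-padded enumeration `τ` of an orthogonal family `F` with the
values of an injective `V : Fin m → Set (G → ℂ)` listed FIRST (`τ i = V i`), satisfying the first three fields of
`IsAdaptedONB`.  (3) `exists_orthonormal_fun_basis`: a finite-dimensional submodule `Wfd ⊆ V` of an invariant subspace
has an `S.inner`-orthonormal basis of FUNCTIONS spanning it — pulled back along the `L²(DG)`-class map (a linear map
on `Wfd`, injective on continuous invariant functions by `eq_of_ae_eq_DG`) from an orthonormal basis of the image.
(4) `exists_gramSchmidt_prefix`: the glue's Gram–Schmidt inside `V` (`AdaptedONBGlue.exists_gramSchmidt`) with a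
prescribed orthonormal prefix KEPT (`gramSchmidtNormed_eq_self_of_lt`: Gram–Schmidt fixes an orthonormal initial
segment).

HC_CM is NOT proved by anyone in this repository.
-/

set_option autoImplicit false

noncomputable section

namespace Summit.Ventures.HodgeRepro.Tier4.Line4

open Summit.Ventures.HodgeRepro.Tier4.Line1 MeasureTheory Topology
open scoped ComplexConjugate InnerProductSpace

variable {G : Type} [Group G] [TopologicalSpace G] [IsTopologicalGroup G] [MeasurableSpace G]
  [BorelSpace G]

variable (S : RTF.Setting G)

omit [IsTopologicalGroup G] [BorelSpace G] in
/-- **Zorn above a given family**: every orthogonal family of non-zero irreducible invariant subspaces is contained in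
a maximal one. -/
theorem exists_maximal_orthFamily_extending {F₀ : Set (Set (G → ℂ))} (hF₀ : S.IsOrthFamily F₀) :
    ∃ F : Set (Set (G → ℂ)), S.IsOrthFamily F ∧ F₀ ⊆ F ∧
      ∀ F', S.IsOrthFamily F' → F ⊆ F' → F' = F := by
  obtain ⟨F, hsub, hmax⟩ := zorn_subset_nonempty {F : Set (Set (G → ℂ)) | S.IsOrthFamily F}
    (fun c hc hchain _ => ⟨⋃₀ c, S.isOrthFamily_sUnion hchain (fun F hF => hc hF),
      fun F hF => Set.subset_sUnion_of_mem hF⟩) F₀ hF₀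
  exact ⟨F, hmax.prop, hsub, fun F' hF' hle => (hmax.eq_of_subset hF' hle).symm⟩

omit [IsTopologicalGroup G] [BorelSpace G] in
/-- A subfamily of an orthogonal family is an orthogonal family. -/
theorem isOrthFamily_subset {F F' : Set (Set (G → ℂ))} (hF : S.IsOrthFamily F) (h : F' ⊆ F) :
    S.IsOrthFamily F' :=
  ⟨fun V hV => hF.1 V (h hV), fun V hV V' hV' hne ψ hψ ψ' hψ' => hF.2 V (h hV) V' (h hV') hne ψ hψ ψ' hψ'⟩

/-- **Enumeration with a given finite family FIRST**: for an orthogonal family `F` containing the values of an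
injective `V : Fin m → Set (G → ℂ)`, a `{0}`-padded enumeration `τ` of `F` with `τ i = V i` for `i < m`, satisfying
the first three fields of `IsAdaptedONB`. -/
theorem exists_enumeration_orthFamily_first [SecondCountableTopology G] {F : Set (Set (G → ℂ))}
    (hF : S.IsOrthFamily F) {m : ℕ} (V : Fin m → Set (G → ℂ)) (hVF : ∀ i, V i ∈ F)
    (hVinj : Function.Injective V) :
    ∃ τ : ℕ → Set (G → ℂ), (∀ j, S.IsInvariantSubspace (τ j)) ∧ (∀ j, S.IsIrreducible (τ j)) ∧
      (∀ j j', j ≠ j' → ∀ ψ ∈ τ j, ∀ ψ' ∈ τ j', S.inner ψ ψ' = 0) ∧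
      (∀ i : Fin m, τ i = V i) ∧ (∀ W ∈ F, ∃ j, τ j = W) := by
  classical
  set F' : Set (Set (G → ℂ)) := F \ Set.range V with hF'def
  have hF' : S.IsOrthFamily F' := isOrthFamily_subset S hF Set.sdiff_subset
  obtain ⟨τ', hinv', hirr', horth', hmem', hall'⟩ := S.exists_enumeration_orthFamily hF'
  let τ : ℕ → Set (G → ℂ) := fun j => if h : j < m then V ⟨j, h⟩ else τ' (j - m)
  have hτlt : ∀ (j : ℕ) (h : j < m), τ j = V ⟨j, h⟩ := fun j h => by simp only [τ, dif_pos h]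
  have hτge : ∀ j : ℕ, m ≤ j → τ j = τ' (j - m) := fun j h => by
    simp only [τ, dif_neg (not_lt.2 h)]
  -- a value of `τ'` is `{0}` or a member of `F` different from every `V i`
  have hτ'cases : ∀ j, τ' j = {0} ∨ (τ' j ∈ F ∧ ∀ i, τ' j ≠ V i) := by
    intro j
    rcases hmem' j with h | h
    · exact Or.inl h
    · refine Or.inr ⟨h.1, fun i hi => h.2 ⟨i, hi.symm⟩⟩
  refine ⟨τ, fun j => ?_, fun j => ?_, fun j j' hne ψ hψ ψ' hψ' => ?_, fun i => ?_, fun W hW => ?_⟩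
  · by_cases h : j < m
    · rw [hτlt j h]; exact (hF.1 _ (hVF _)).1
    · rw [hτge j (not_lt.1 h)]; exact hinv' _
  · by_cases h : j < m
    · rw [hτlt j h]; exact (hF.1 _ (hVF _)).2.1
    · rw [hτge j (not_lt.1 h)]; exact hirr' _
  · by_cases h : j < m <;> by_cases h' : j' < m
    · rw [hτlt j h] at hψ
      rw [hτlt j' h'] at hψ'
      have hne' : V ⟨j, h⟩ ≠ V ⟨j', h'⟩ := fun heq => hne (by simpa using congrArg Fin.val (hVinj heq))
      exact hF.2 _ (hVF _) _ (hVF _) hne' ψ hψ ψ' hψ'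
    · rw [hτlt j h] at hψ
      rw [hτge j' (not_lt.1 h')] at hψ'
      rcases hτ'cases (j' - m) with h0 | ⟨hmem, hdiff⟩
      · rw [h0, Set.mem_singleton_iff] at hψ'
        rw [hψ']
        exact S.inner_fun_zero_right ψ
      · exact hF.2 _ (hVF _) _ hmem (fun heq => hdiff _ heq.symm) ψ hψ ψ' hψ'
    · rw [hτge j (not_lt.1 h)] at hψ
      rw [hτlt j' h'] at hψ'
      rcases hτ'cases (j - m) with h0 | ⟨hmem, hdiff⟩
      · rw [h0, Set.mem_singleton_iff] at hψ
        rw [hψ]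
        exact S.inner_fun_zero_left ψ'
      · exact hF.2 _ hmem _ (hVF _) (hdiff _) ψ hψ ψ' hψ'
    · rw [hτge j (not_lt.1 h)] at hψ
      rw [hτge j' (not_lt.1 h')] at hψ'
      have hne' : j - m ≠ j' - m := fun heq => hne (by omega)
      exact horth' _ _ hne' ψ hψ ψ' hψ'
  · exact hτlt i.1 i.2
  · by_cases hW' : W ∈ Set.range V
    · obtain ⟨i, rfl⟩ := hW'
      exact ⟨i, hτlt i.1 i.2⟩
    · obtain ⟨j, hj⟩ := hall' W ⟨hW, hW'⟩
      refine ⟨m + j, ?_⟩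
      rw [hτge (m + j) (Nat.le_add_right m j), Nat.add_sub_cancel_left]
      exact hj

section FunBasis

variable {V : Set (G → ℂ)} (hV : S.IsInvariantSubspace V) (Wfd : Submodule ℂ (G → ℂ))
  (hW : (Wfd : Set (G → ℂ)) ⊆ V)

include hV hW in
/-- **A function-level orthonormal basis of a finite-dimensional subspace `Wfd ⊆ V`**: `d = dim Wfd` functions
`w k ∈ Wfd` (`k < d`), `S.inner`-orthonormal, spanning `Wfd` — pulled back along the injective `L²(DG)`-class map from an
orthonormal basis of the image of `Wfd` in `L²(DG)`. -/
theorem exists_orthonormal_fun_basis [SecondCountableTopology G] [FiniteDimensional ℂ Wfd] :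
    ∃ (d : ℕ) (w : ℕ → G → ℂ), (∀ k < d, w k ∈ Wfd) ∧
      (∀ k < d, ∀ k' < d, S.inner (w k) (w k') = if k = k' then 1 else 0) ∧
      Submodule.span ℂ (w '' (Finset.range d : Set ℕ)) = Wfd := by
  classical
  haveI : Countable S.Gk := S.countable_Gk
  -- the `L²(DG)`-class map on `Wfd`, as a linear map
  let L : Wfd →ₗ[ℂ] Lp ℂ 2 (S.μ.restrict S.DG) :=
    { toFun := fun ψ => (S.memLp_restrict_of_continuous (hV.cont ψ (hW ψ.2))).toLp ψ
      map_add' := fun ψ ψ' => by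
        simp only [Submodule.coe_add]
        exact MemLp.toLp_add _ _
      map_smul' := fun c ψ => by
        simp only [Submodule.coe_smul, RingHom.id_apply]
        exact MemLp.toLp_const_smul c _ }
  have hLapply : ∀ ψ : Wfd, L ψ = S.toL2 (hV.cont ψ (hW ψ.2)) := fun ψ => rfl
  -- `L` is injective: two continuous invariant functions with the same class agree (`eq_of_ae_eq_DG`)
  have hLinj : Function.Injective L := by
    intro ψ ψ' h
    apply Subtype.ext
    have hae : (ψ : G → ℂ) =ᵐ[S.μ.restrict S.DG] ψ' :=
      (MemLp.toLp_eq_toLp_iff (S.memLp_restrict_of_continuous (hV.cont _ (hW ψ.2)))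
        (S.memLp_restrict_of_continuous (hV.cont _ (hW ψ'.2)))).1 h
    exact S.eq_of_ae_eq_DG (hV.inv _ (hW ψ.2)) (hV.cont _ (hW ψ.2)) (hV.inv _ (hW ψ'.2))
      (hV.cont _ (hW ψ'.2)) hae
  set b := stdOrthonormalBasis ℂ (LinearMap.range L) with hb
  set d := Module.finrank ℂ (LinearMap.range L) with hd
  have hbk : ∀ k : Fin d, ∃ ψ : Wfd, L ψ = (b k : Lp ℂ 2 (S.μ.restrict S.DG)) :=
    fun k => LinearMap.mem_range.1 (b k).2
  choose ψ hψ using hbk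
  let w : ℕ → G → ℂ := fun k => if h : k < d then (ψ ⟨k, h⟩ : G → ℂ) else 0
  have hw : ∀ (k : ℕ) (hk : k < d), w k = ψ ⟨k, hk⟩ := fun k hk => by simp only [w, dif_pos hk]
  refine ⟨d, w, fun k hk => ?_, fun k hk k' hk' => ?_, ?_⟩
  · rw [hw k hk]
    exact (ψ ⟨k, hk⟩).2
  · rw [hw k hk, hw k' hk', S.inner_eq_inner_toL2 (hV.cont _ (hW (ψ ⟨k, hk⟩).2))
      (hV.cont _ (hW (ψ ⟨k', hk'⟩).2)), ← hLapply, ← hLapply, hψ, hψ, ← Submodule.coe_inner,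
      orthonormal_iff_ite.1 b.orthonormal]
    by_cases h : k = k'
    · subst h
      simp
    · rw [if_neg h, if_neg]
      intro h'
      have h'' := congrArg Fin.val h'
      first
        | exact h h''
        | exact h h''.symm
  · apply le_antisymm
    · rw [Submodule.span_le]
      rintro _ ⟨k, hk, rfl⟩
      have hk' : k < d := by simpa using hk
      rw [SetLike.mem_coe, hw k hk']
      exact (ψ ⟨k, hk'⟩).2
    · intro x hx
      set u : LinearMap.range L := ⟨L ⟨x, hx⟩, LinearMap.mem_range_self L _⟩ with hu
      have hsum := b.sum_repr u
      have hx' : (⟨x, hx⟩ : Wfd) = ∑ i, b.repr u i • ψ i := by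
        apply hLinj
        rw [map_sum]
        simp_rw [map_smul, hψ]
        have h1 := congrArg Subtype.val hsum
        rw [Submodule.coe_sum] at h1
        simp_rw [Submodule.coe_smul] at h1
        exact h1.symm
      have hx'' : x = ∑ i, b.repr u i • (ψ i : G → ℂ) := by
        have h1 := congrArg Subtype.val hx'
        rw [Submodule.coe_sum] at h1
        simp_rw [Submodule.coe_smul] at h1
        exact h1
      rw [hx'']
      refine Submodule.sum_mem _ fun i _ => Submodule.smul_mem _ _ (Submodule.subset_span ?_)
      refine ⟨i.1, by simp [i.2], ?_⟩
      rw [hw i.1 i.2]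

end FunBasis

section GramSchmidtPrefix

/-- `gramSchmidt` leaves an orthonormal initial segment unchanged. -/
theorem gramSchmidt_eq_self_of_lt {E : Type} [NormedAddCommGroup E] [InnerProductSpace ℂ E] [CompleteSpace E]
    (f : ℕ → E) (d : ℕ) (horth : ∀ i < d, ∀ j < d, ⟪f i, f j⟫_ℂ = if i = j then 1 else 0) :
    ∀ n < d, InnerProductSpace.gramSchmidt ℂ f n = f n := by
  intro n
  induction n using Nat.strong_induction_on with
  | _ n ih =>
    intro hn
    rw [InnerProductSpace.gramSchmidt_def, Finset.sum_eq_zero, sub_zero]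
    intro i hi
    rw [Finset.mem_Iio] at hi
    rw [ih i hi (hi.trans hn), Submodule.starProjection_apply_eq_zero_iff,
      Submodule.mem_orthogonal_singleton_iff_inner_right, horth i (hi.trans hn) n hn, if_neg hi.ne]

/-- `gramSchmidtNormed` leaves an orthonormal initial segment unchanged. -/
theorem gramSchmidtNormed_eq_self_of_lt {E : Type} [NormedAddCommGroup E] [InnerProductSpace ℂ E]
    [CompleteSpace E] (f : ℕ → E) (d : ℕ) (horth : ∀ i < d, ∀ j < d, ⟪f i, f j⟫_ℂ = if i = j then 1 else 0) :
    ∀ n < d, InnerProductSpace.gramSchmidtNormed ℂ f n = f n := by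
  intro n hn
  unfold InnerProductSpace.gramSchmidtNormed
  rw [gramSchmidt_eq_self_of_lt f d horth n hn]
  have h1 : ‖f n‖ = 1 := by
    have h := horth n hn n hn
    rw [if_pos rfl, inner_self_eq_norm_sq_to_K] at h
    have h2 : (‖f n‖ ^ 2 : ℝ) = 1 := by
      have h' : ((‖f n‖ ^ 2 : ℝ) : ℂ) = ((1 : ℝ) : ℂ) := by
        push_cast
        exact h
      exact Complex.ofReal_inj.1 h'
    nlinarith [norm_nonneg (f n)]
  rw [h1]
  simp

variable {V : Set (G → ℂ)} (hV : S.IsInvariantSubspace V)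

omit [IsTopologicalGroup G] in
/-- **Gram–Schmidt inside `V` with a prescribed orthonormal PREFIX**: given `d` members `w k ∈ V` (`k < d`),
`S.inner`-orthonormal, a sequence `g` of `L²(DG)`-vectors whose first `d` terms are the classes of the `w k`, whose
non-zero terms are classes of members of `V`, pairwise orthonormal, and total for `clsSet V`. -/
theorem exists_gramSchmidt_prefix [SecondCountableTopology G] (d : ℕ) (w : ℕ → G → ℂ) (hw : ∀ k < d, w k ∈ V)
    (horth : ∀ k < d, ∀ k' < d, S.inner (w k) (w k') = if k = k' then 1 else 0) :
    ∃ g : ℕ → Lp ℂ 2 (S.μ.restrict S.DG),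
      (∀ (k : ℕ) (hk : k < d), g k = S.toL2 (hV.cont _ (hw k hk))) ∧
      (∀ k, g k ≠ 0 → g k ∈ S.clsSet V) ∧
      (∀ k k', g k ≠ 0 → g k' ≠ 0 → ⟪g k, g k'⟫_ℂ = if k = k' then 1 else 0) ∧
      ∀ u ∈ S.clsSet V, ∀ v : Lp ℂ 2 (S.μ.restrict S.DG), (∀ k, ⟪g k, v⟫_ℂ = 0) → ⟪u, v⟫_ℂ = 0 := by
  classical
  obtain ⟨c, hcsub, hcc, hcd⟩ := S.exists_countable_dense_clsSet V
  obtain ⟨e, he⟩ := (hcc.insert (0 : Lp ℂ 2 (S.μ.restrict S.DG))).exists_eq_range ⟨0, Set.mem_insert _ _⟩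
  let e' : ℕ → Lp ℂ 2 (S.μ.restrict S.DG) :=
    fun k => if h : k < d then S.toL2 (hV.cont _ (hw k h)) else e (k - d)
  have he'lt : ∀ (k : ℕ) (hk : k < d), e' k = S.toL2 (hV.cont _ (hw k hk)) := fun k hk => by
    simp only [e', dif_pos hk]
  have he'ge : ∀ k, d ≤ k → e' k = e (k - d) := fun k hk => by simp only [e', dif_neg (not_lt.2 hk)]
  have he'orth : ∀ i < d, ∀ j < d, ⟪e' i, e' j⟫_ℂ = if i = j then 1 else 0 := by
    intro i hi j hj
    rw [he'lt i hi, he'lt j hj, ← S.inner_eq_inner_toL2, horth j hj i hi]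
    by_cases h : i = j
    · subst h
      simp
    · rw [if_neg h, if_neg (Ne.symm h)]
  set g : ℕ → Lp ℂ 2 (S.μ.restrict S.DG) := InnerProductSpace.gramSchmidtNormed ℂ e' with hg
  have hrange : Set.range e' ⊆ insert 0 (S.clsSet V) := by
    rintro _ ⟨k, rfl⟩
    by_cases hk : k < d
    · rw [he'lt k hk]
      exact Set.mem_insert_of_mem _ ⟨w k, hw k hk, _, rfl⟩
    · rw [he'ge k (not_lt.1 hk)]
      have : e (k - d) ∈ insert 0 c := he ▸ Set.mem_range_self _
      exact Set.insert_subset_insert hcsub this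
  have hc_sub : c ⊆ Set.range e' := by
    intro u hu
    have : u ∈ Set.range e := he ▸ Set.mem_insert_of_mem _ hu
    obtain ⟨k, rfl⟩ := this
    exact ⟨k + d, by rw [he'ge (k + d) (Nat.le_add_left d k), Nat.add_sub_cancel]⟩
  have hspan : Submodule.span ℂ (Set.range g) = Submodule.span ℂ (Set.range e') := by
    rw [hg, InnerProductSpace.span_gramSchmidtNormed_range, InnerProductSpace.span_gramSchmidt]
  refine ⟨g, fun k hk => ?_, fun k hk => ?_, fun k k' hk hk' => ?_, fun u hu v hv => ?_⟩
  · rw [hg, gramSchmidtNormed_eq_self_of_lt e' d he'orth k hk, he'lt k hk]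
  · apply S.mem_clsSet_of_mem_span hV _ hk
    have hmem : g k ∈ Submodule.span ℂ (Set.range g) := Submodule.subset_span (Set.mem_range_self k)
    rw [hspan] at hmem
    have hle : Submodule.span ℂ (Set.range e') ≤ Submodule.span ℂ (S.clsSet V) := by
      refine (Submodule.span_mono hrange).trans ?_
      rw [Submodule.span_insert_zero]
    exact hle hmem
  · have horth' := orthonormal_iff_ite.1 (InnerProductSpace.gramSchmidtNormed_orthonormal' (𝕜 := ℂ) e')
      (⟨k, hk⟩ : {i | InnerProductSpace.gramSchmidtNormed ℂ e' i ≠ 0})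
      (⟨k', hk'⟩ : {i | InnerProductSpace.gramSchmidtNormed ℂ e' i ≠ 0})
    simp only [Subtype.mk.injEq] at horth'
    exact horth'
  · have hK : IsClosed ((Submodule.span ℂ {v})ᗮ : Set (Lp ℂ 2 (S.μ.restrict S.DG))) :=
      Submodule.isClosed_orthogonal _
    have hsub : (Submodule.span ℂ (Set.range g) : Set (Lp ℂ 2 (S.μ.restrict S.DG))) ⊆
        ((Submodule.span ℂ {v})ᗮ : Set (Lp ℂ 2 (S.μ.restrict S.DG))) := by
      intro x hx
      have : Submodule.span ℂ (Set.range g) ≤ (Submodule.span ℂ {v})ᗮ := by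
        rw [Submodule.span_le]
        rintro _ ⟨k, rfl⟩
        exact Submodule.mem_orthogonal_singleton_iff_inner_right.2 (inner_eq_zero_symm.1 (hv k))
      exact this hx
    have hcl : closure c ⊆ ((Submodule.span ℂ {v})ᗮ : Set (Lp ℂ 2 (S.μ.restrict S.DG))) := by
      rw [hK.closure_subset_iff]
      refine Set.Subset.trans ?_ hsub
      rw [hspan]
      exact hc_sub.trans Submodule.subset_span
    have : u ∈ (Submodule.span ℂ {v})ᗮ := hcl (hcd hu)
    exact inner_eq_zero_symm.1 (Submodule.mem_orthogonal_singleton_iff_inner_right.1 this)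

end GramSchmidtPrefix


end Summit.Ventures.HodgeRepro.Tier4.Line4

end
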